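import Mathlib.Analysis.InnerProductSpace.Projection.Reflection
import Literature.Analysis.UnboundedOperators.LinearizedBoltzmann
import Literature.Analysis.UnboundedOperators.LinearizedBoltzmannPositivityProofs
import HarnessLib

/-!
# Orthogonality of the Burnett function `A_{ij}` to the collision invariants: discharge

Sibling proof file of `LinearizedBoltzmann.lean` (D-0014: named facts `def X : Prop` are
discharged as `theorem X_holds : X`). It discharges

* `Literature.Analysis.UnboundedOperators.burnettA_orthogonal_collisionInvariants_holds :
  burnettA_orthogonal_collisionInvariants` — for every orthonormal basis `b` of the velocity space
  `E`, all `i j`, and every collision invariant `φ ∈ span {1, ⟪·, e⟫, |·|²}`,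
  `⟪A_{ij}, φ⟫_M = ∫ A_{ij} φ dM = 0`, where `A_{ij}(v) = vᵢ vⱼ - δ_{ij} |v|² / d` is the
  (momentum-flux) Burnett function and `M dv = stdGaussian E` the normalised Maxwellian.

Source. Bardos–Golse–Levermore, *Fluid dynamic limits of kinetic equations II: convergence
proofs for the Boltzmann equation*, Comm. Pure Appl. Math. 46 (1993), §1, (1.45)–(1.46),
pp. 675–676: the null space `N(L)` is `{a + β·v + γ |v|²/2}` and the functions
`A(v) = v ⊗ v - (1/D)|v|² I`, `B(v) = ½(|v|² - (D+2)) v` are the right-hand sides of `L Φ = A`,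
`L Ψ = B`, solvable precisely because `A, B ⊥ N(L)`; stated explicitly (for `D = 3`) in
Golse–Saint-Raymond, Invent. Math. 155 (2004), Prop. 1.4 and (1.42), p. 93: *"each entry of the
tensor `v^{⊗2} - ⅓|v|² I` … is orthogonal to `ker L`"*.

Proof (Gaussian symmetries only; no moment of the Gaussian is computed). The Maxwellian
`stdGaussian E` is invariant under every linear isometry `R` of `E` (Mathlib's
`ProbabilityTheory.stdGaussian_map`), so an integrand `g` with `g ∘ R = -g` has integral `0`:
* `φ = ⟪·, e⟫`: `A_{ij}(v) ⟪v, e⟫` is odd under `v ↦ -v`;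
* `φ` radial (`1`, `|v|²`) and `i ≠ j`: `A_{ij} φ` is odd under the reflection in the hyperplane
  `(b i)ᗮ`, which flips the `i`-th coordinate and fixes the others;
* `φ` radial and `i = j`: `d · A_{ii} = ∑ₖ (vᵢ² - vₖ²)` (Parseval), and `(vᵢ² - vₖ²) φ` is odd
  under the reflection in `(b i - b k)ᗮ`, which exchanges the coordinates `i` and `k`; pulling
  the finite sum out of the integral uses integrability, which holds for every function of
  temperate growth (`integrable_stdGaussian_of_hasTemperateGrowth` of the sibling file
  `LinearizedBoltzmannPositivityProofs.lean`: polynomial bound + Gaussian moments of all orders);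
* a general collision invariant is reached by `Submodule.span_induction` (linearity of the
  integral on integrable, temperate-growth integrands).

Mathlib anchors: `Submodule.reflection`, `Submodule.reflection_sub`,
`Submodule.reflection_orthogonalComplement_singleton_eq_neg`, `OrthonormalBasis.sum_sq_inner_right`,
`MeasureTheory.MeasurePreserving.integral_comp`, `ProbabilityTheory.stdGaussian_map`,
`MeasureTheory.integral_finsetSum`, `Submodule.span_induction`.
-/

open MeasureTheory ProbabilityTheory Module
open scoped InnerProductSpace

namespace Literature.Analysis.UnboundedOperators

noncomputable section

variable {E : Type*} [NormedAddCommGroup E] [InnerProductSpace ℝ E]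

/-! ### Reflections flipping or exchanging basis vectors -/

/-- A reflection is a symmetric operator: `⟪x, R v⟫ = ⟪R x, v⟫` (it is an involutive isometry).
[folklore] -/
theorem inner_reflection_right (K : Submodule ℝ E) [K.HasOrthogonalProjection] (x v : E) :
    ⟪x, K.reflection v⟫_ℝ = ⟪K.reflection x, v⟫_ℝ := by
  rw [← K.reflection.inner_map_map x (K.reflection v), Submodule.reflection_reflection]

section Basis

variable {ι : Type*} [Fintype ι]

/-- Coordinates after the reflection in the hyperplane `(b i)ᗮ`: the `i`-th coordinate changes
sign, the other coordinates are unchanged. [folklore] -/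
theorem inner_basis_reflection_flip [DecidableEq ι] (b : OrthonormalBasis ι ℝ E) (i m : ι)
    (v : E) :
    ⟪b m, (ℝ ∙ b i)ᗮ.reflection v⟫_ℝ = if m = i then -⟪b m, v⟫_ℝ else ⟪b m, v⟫_ℝ := by
  rw [inner_reflection_right]
  split_ifs with h
  · rw [h, Submodule.reflection_orthogonalComplement_singleton_eq_neg, inner_neg_left]
  · rw [Submodule.reflection_mem_subspace_eq_self
      (Submodule.mem_orthogonal_singleton_iff_inner_right.2 (b.inner_eq_zero (Ne.symm h)))]

/-- The reflection in the hyperplane `(b i - b k)ᗮ` maps `b i` to `b k`. [folklore] -/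
theorem reflection_basis_swap_left (b : OrthonormalBasis ι ℝ E) (i k : ι) :
    (ℝ ∙ (b i - b k))ᗮ.reflection (b i) = b k :=
  Submodule.reflection_sub (by rw [b.norm_eq_one, b.norm_eq_one])

/-- The reflection in the hyperplane `(b i - b k)ᗮ` maps `b k` to `b i`. [folklore] -/
theorem reflection_basis_swap_right (b : OrthonormalBasis ι ℝ E) (i k : ι) :
    (ℝ ∙ (b i - b k))ᗮ.reflection (b k) = b i := by
  have h := congrArg ((ℝ ∙ (b i - b k))ᗮ.reflection) (reflection_basis_swap_left b i k)
  rw [Submodule.reflection_reflection] at h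
  exact h.symm

/-- The Burnett function `A_{ij}` written with inner products against the basis vectors:
`A_{ij}(v) = ⟪b i, v⟫ ⟪b j, v⟫ - δ_{ij} |v|² / d`. [folklore] -/
theorem burnettA_apply [DecidableEq ι] (b : OrthonormalBasis ι ℝ E) (i j : ι) (v : E) :
    burnettA b i j v =
      ⟪b i, v⟫_ℝ * ⟪b j, v⟫_ℝ - if i = j then ‖v‖ ^ 2 / (finrank ℝ E : ℝ) else 0 := by
  simp only [burnettA, OrthonormalBasis.repr_apply_apply]

end Basis

/-! ### Gaussian integrals: isometry invariance -/

variable [FiniteDimensional ℝ E] [MeasurableSpace E] [BorelSpace E]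

/-- Change of variables under a linear isometry in a Maxwellian integral:
`∫ g (R v) dM(v) = ∫ g dM` (the Gaussian is `R`-invariant; no integrability needed). [folklore] -/
theorem integral_comp_linearIsometryEquiv_stdGaussian (f : E ≃ₗᵢ[ℝ] E) (g : E → ℝ) :
    ∫ v, g (f v) ∂stdGaussian E = ∫ v, g v ∂stdGaussian E :=
  (⟨f.continuous.measurable, stdGaussian_map f⟩ :
      MeasurePreserving f (stdGaussian E) (stdGaussian E)).integral_comp
    f.toHomeomorph.measurableEmbedding g

/-- An integrand that is odd under some linear isometry of `E` has zero Maxwellian integral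
(junk value `0` included: no integrability is needed). [folklore] -/
theorem integral_stdGaussian_eq_zero_of_odd (f : E ≃ₗᵢ[ℝ] E) {g : E → ℝ}
    (hg : ∀ v, g (f v) = -g v) : ∫ v, g v ∂stdGaussian E = 0 := by
  have h := integral_comp_linearIsometryEquiv_stdGaussian f g
  simp only [hg, integral_neg] at h
  linarith

/-! ### The three symmetry computations and the discharge -/

section Burnett

variable {ι : Type*} [Fintype ι] [DecidableEq ι]

/-- Odd part: `∫ A_{ij}(v) ⟪v, e⟫ dM = 0`, the integrand being odd under `v ↦ -v`. [folklore] -/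
theorem integral_burnettA_mul_inner_eq_zero (b : OrthonormalBasis ι ℝ E) (i j : ι) (e : E) :
    ∫ v, burnettA b i j v * ⟪v, e⟫_ℝ ∂stdGaussian E = 0 := by
  refine integral_stdGaussian_eq_zero_of_odd (LinearIsometryEquiv.neg ℝ) fun v => ?_
  simp only [LinearIsometryEquiv.coe_neg, burnettA_apply, inner_neg_right, inner_neg_left,
    norm_neg]
  ring

/-- Off-diagonal radial part: for `i ≠ j` and an isometry-invariant weight `W`,
`∫ A_{ij} W dM = 0`, the integrand being odd under the reflection in `(b i)ᗮ`. [folklore] -/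
theorem integral_burnettA_mul_eq_zero_of_ne (b : OrthonormalBasis ι ℝ E) {i j : ι} (hij : i ≠ j)
    {W : E → ℝ} (hW : ∀ (f : E ≃ₗᵢ[ℝ] E) (v : E), W (f v) = W v) :
    ∫ v, burnettA b i j v * W v ∂stdGaussian E = 0 := by
  have hji : j ≠ i := Ne.symm hij
  refine integral_stdGaussian_eq_zero_of_odd (ℝ ∙ b i)ᗮ.reflection fun v => ?_
  simp only [hW, burnettA_apply, inner_basis_reflection_flip, if_true, if_neg hji, if_neg hij]
  ring

/-- Diagonal radial part: for an isometry-invariant weight `W` of temperate growth,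
`∫ A_{ii} W dM = 0`. Write `d · A_{ii} = ∑ₖ (vᵢ² - vₖ²)` (Parseval); each `(vᵢ² - vₖ²) W` is odd
under the reflection exchanging `b i` and `b k`, and the finite sum is pulled out of the integral
by integrability of temperate-growth functions. [folklore] -/
theorem integral_burnettA_self_mul_eq_zero (b : OrthonormalBasis ι ℝ E) (i : ι) {W : E → ℝ}
    (hWt : W.HasTemperateGrowth) (hW : ∀ (f : E ≃ₗᵢ[ℝ] E) (v : E), W (f v) = W v) :
    ∫ v, burnettA b i i v * W v ∂stdGaussian E = 0 := by
  have hk : ∀ k, ∫ v, (⟪b i, v⟫_ℝ ^ 2 - ⟪b k, v⟫_ℝ ^ 2) * W v ∂stdGaussian E = 0 := by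
    intro k
    refine integral_stdGaussian_eq_zero_of_odd (ℝ ∙ (b i - b k))ᗮ.reflection fun v => ?_
    simp only [hW, inner_reflection_right, reflection_basis_swap_left,
      reflection_basis_swap_right]
    ring
  have hint : ∀ k,
      Integrable (fun v => (⟪b i, v⟫_ℝ ^ 2 - ⟪b k, v⟫_ℝ ^ 2) * W v) (stdGaussian E) :=
    fun k => integrable_stdGaussian_of_hasTemperateGrowth (by fun_prop)
  have hd : (finrank ℝ E : ℝ) = Fintype.card ι := by
    rw [Module.finrank_eq_card_basis b.toBasis]
  have hd0 : (Fintype.card ι : ℝ) ≠ 0 := by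
    have : Nonempty ι := ⟨i⟩
    exact Nat.cast_ne_zero.2 Fintype.card_ne_zero
  have hpt : (fun v => burnettA b i i v * W v) =
      fun v => (Fintype.card ι : ℝ)⁻¹ * ∑ k, (⟪b i, v⟫_ℝ ^ 2 - ⟪b k, v⟫_ℝ ^ 2) * W v := by
    funext v
    rw [burnettA_apply, if_pos rfl, hd, ← Finset.sum_mul, Finset.sum_sub_distrib,
      Finset.sum_const, Finset.card_univ, nsmul_eq_mul, b.sum_sq_inner_right]
    field_simp
  rw [hpt, integral_const_mul, integral_finsetSum _ fun k _ => hint k]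
  simp [hk]

/-- **Discharge** of `burnettA_orthogonal_collisionInvariants` (Bardos–Golse–Levermore 1993, §1
(1.45)–(1.46), pp. 675–676; explicitly Golse–Saint-Raymond 2004, Prop. 1.4 and (1.42), p. 93):
the Burnett function `A_{ij}(v) = vᵢ vⱼ - δ_{ij} |v|²/d` is `M`-orthogonal to every collision
invariant, `∫ A_{ij} φ dM = 0` for `φ ∈ span {1, ⟪·, e⟫, |·|²}`. By span induction from the three
generators: `⟪·, e⟫` by oddness under `v ↦ -v`, and the radial generators `1`, `|v|²` by the
coordinate reflections (`i ≠ j`) and coordinate exchanges (`i = j`); no hypothesis on the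
dimension is needed. [cite: BardosGolseLevermore1993, §1 (1.45)–(1.46) pp. 675–676] -/
theorem burnettA_orthogonal_collisionInvariants_holds :
    burnettA_orthogonal_collisionInvariants (E := E) (ι := ι) := by
  intro b i j φ hφ
  unfold maxwellianInner
  have hrad : ∀ {W : E → ℝ}, W.HasTemperateGrowth → (∀ (f : E ≃ₗᵢ[ℝ] E) (v : E), W (f v) = W v) →
      ∫ v, burnettA b i j v * W v ∂stdGaussian E = 0 := by
    intro W hWt hW
    rcases eq_or_ne i j with rfl | hij
    · exact integral_burnettA_self_mul_eq_zero b i hWt hW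
    · exact integral_burnettA_mul_eq_zero_of_ne b hij hW
  have hI : ∀ {ψ : E → ℝ}, ψ ∈ collisionInvariants E →
      Integrable (fun v => burnettA b i j v * ψ v) (stdGaussian E) := by
    intro ψ hψ
    have hA : (burnettA b i j).HasTemperateGrowth := burnettA_mem_temperateGrowth b i j
    have hψ' : ψ.HasTemperateGrowth := collisionInvariants_le_temperateGrowth hψ
    exact integrable_stdGaussian_of_hasTemperateGrowth (hA.mul hψ')
  induction hφ using Submodule.span_induction with
  | mem x hx =>
    simp only [Set.mem_union, Set.mem_insert_iff, Set.mem_singleton_iff, Set.mem_range] at hx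
    rcases hx with (rfl | rfl) | ⟨e, rfl⟩
    · exact hrad (Function.HasTemperateGrowth.const 1) fun f v => rfl
    · exact hrad (Function.hasTemperateGrowth_norm_sq E) fun f v => by
        simp only [LinearIsometryEquiv.norm_map]
    · exact integral_burnettA_mul_inner_eq_zero b i j e
  | zero => simp
  | add x y hx hy ihx ihy =>
    have : (fun v => burnettA b i j v * (x + y) v) =
        fun v => burnettA b i j v * x v + burnettA b i j v * y v := by
      funext v
      simp only [Pi.add_apply, mul_add]
    rw [this, integral_add (hI hx) (hI hy), ihx, ihy, add_zero]
  | smul a x hx ihx =>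
    have : (fun v => burnettA b i j v * (a • x) v) = fun v => a * (burnettA b i j v * x v) := by
      funext v
      simp only [Pi.smul_apply, smul_eq_mul]
      ring
    rw [this, integral_const_mul, ihx, mul_zero]

end Burnett

end

end Literature.Analysis.UnboundedOperators
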